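/-
Copyright (c) 2026 the pub-hodgecm-mathlib formalisation cell (harness21).  Prover seat hodgecm-mathlib-K2Liu-p09 (g8), Track B «K2-LIT» ∕ hLiu418
#184♮, Road I v3, unit U5 «THE CLOSE», FACE-G letter L2 (G-Θ), organ (W-orb), road (C2) of RULING M-158y, input of (C2-B): the one-place Lie derivative
of (G2-W2) packaged as ONE continuous `ℂ`-linear operator (box K2E5-r02 (g6) 23:42:54Z guard «`A` global, `ℂ`-linear, the same on every vector»).
THEOREMS ONLY.  2026-09-05.
-/
import Summits.HodgeConjecture.HodgeConjecture.Theorems.K2LiuWeilDatumLieDerivativeU22     -- ★ (G2-W2 along every `X`): `hasDerivAt_weilDatum_expMem_smul'`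
import HarnessLib

/-!
# (G2-W2, operator form) The Lie derivative of an archimedean Weil datum of `U(2,2) × U(R,S)` along `X ∈ 𝔲(2,2)` IS ONE CONTINUOUS `ℂ`-LINEAR OPERATOR
# `dω(X) : 𝓢 →L[ℂ] 𝓢`: `d∕dt|₀ T (ω (exp (t X), 1) Φ) = T (dω(X) Φ)` for every `Φ` and every continuous `ℝ`-linear `T`

Track B ∕ K2-LIT, hLiu418 = stmt-HodgeConjecture-24832, #42F′ FACE-G letter L2, organ (W-orb), road (C2) (RULING M-158y).  Namespace
`Summit.HodgeConjecture.HodgeConjecture.Cruxes.HLiu418.K2LiuWeilDatumSmoothU22` (continued).  THEOREMS ONLY (no definition, no instance, no notation, no named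
fact, no `sorry`); the Mathlib idiom `attribute [local instance 100] LieRing.ofAssociativeRing` as in (G2-W2); `--supports stmt-HodgeConjecture-24832 --as helper`.

★ (G2-W2) `hasDerivAt_weilDatum_expMem_smul'` gives the derivative of `t ↦ T (ω (exp tX, 1) Φ)` at `0` as `T` of the explicit Schwartz vector
`Σᵢ aᵢ(X) • preᵢ (genᵢ (postᵢ Φ))` (the sixteen conjugated letters ★ `u22LetterOp`, `aᵢ(X)` the coordinates of `X` in ★ `u22AdaptedBasis`).  The (C2) closure
organ of the (W-orb) letter (★ `K2LiuArchOrbitDerivClosure.thetaOrbitLetter_of_dense(_span)`) needs the derivative ON A DENSE CLASS to be given by ONE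
continuous linear operator `A` defined on the whole space (box K2E5-r02 (g6): this is load-bearing — a vector-dependent `Ψ′` would not close up), and the
all-variables lift of a one-place operator is ★ `SegalBargmann.SchwartzTensorOperators.tensorOp` — which wants a `ℂ`-linear CLM.  THIS FILE packages (G2-W2)'s
derivative as that CLM:

* **`hasDerivAt_weilDatum_expMem_smul_clm`** — with the operator
  `dω(X) := Σᵢ (aᵢ(X) : ℂ) • preᵢ ∘L genᵢ ∘L postᵢ : 𝓢 →L[ℂ] 𝓢` WRITTEN OUT (the letters' `pre ∕ gen ∕ post` are ★ `ℂ`-linear CLMs):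
  `HasDerivAt (t ↦ T (ω (exp (t X), 1) Φ)) (T (dω(X) Φ)) 0`;
* **`exists_clm_hasDerivAt_weilDatum_expMem_smul`** — `∃ D : 𝓢 →L[ℂ] 𝓢, ∀ T Φ, HasDerivAt (t ↦ T (ω (exp (t X), 1) Φ)) (T (D Φ)) 0` (the shape the (C2-B)
  payer feeds to `tensorOp D 1` and then to ★ `thetaOrbitLetter_of_dense_span`'s binder `A`).

HONEST LABEL: HC_CM is proved only modulo the 7 printed citations (2 remaining named inputs: hLiu418 = stmt-HodgeConjecture-24832, h413 =
stmt-HodgeConjecture-24833) until rung 0 closes; organ capital for #42F′'s Road I, moves no counter.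

## References
* [Varadarajan1984] V. S. Varadarajan, *Lie Groups, Lie Algebras, and Their Representations* (1984), Thm. 2.10.1, (2.10.19).
* [Folland1989] G. B. Folland, *Harmonic Analysis in Phase Space* (1989), §4.2, (4.24), Prop. (4.39).
-/

set_option autoImplicit false
set_option linter.dupNamespace false

noncomputable section

open scoped MatrixGroups Matrix Topology SchwartzMap Matrix.Norms.Operator
open Filter
open Literature.NumberTheory.Automorphic Literature.Analysis.SegalBargmann Literature.NumberTheory.Weil1964
open Literature.RepresentationTheory.KonnoKonno2007 hiding LetterKind letterOf letterGen letterOf_boost letterOf_torus letterOf_torus_eq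
  letterGen_boost letterGen_torus letterGen_mem_lie exp_smul_letterGen
open Literature.RepresentationTheory.KonnoKonno2007.RealDualPair
open Literature.RepresentationTheory.KonnoKonno2007.RealDualPair.UForm
open Summit.HodgeConjecture.HodgeConjecture.Cruxes.HLiu418.K2LiuU22AdaptedBasis

-- Mathlib idiom (`Mathlib/Algebra/Lie/OfAssociative.lean`), as in ★ `RealMatrixGroups` ∕ (G2-W2): the commutator bracket on `Matrix n n ℂ`, needed to name
-- the Lie subalgebra `(uFormGroup (Fin 2) (Fin 2)).lie`
attribute [local instance 100] LieRing.ofAssociativeRing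

namespace Summit.HodgeConjecture.HodgeConjecture.Cruxes.HLiu418.K2LiuWeilDatumSmoothU22

variable {R S : Type*} [Fintype R] [DecidableEq R] [Fintype S] [DecidableEq S]
  {V : Type*} [NormedAddCommGroup V] [NormedSpace ℝ V]

/-- **THE LIE DERIVATIVE ALONG `X ∈ 𝔲(2,2)` AS ONE CONTINUOUS `ℂ`-LINEAR OPERATOR, WRITTEN OUT.**  For an archimedean Weil datum `ω` of `U(2,2) × U(R,S)` with
vacuum clause and `X ∈ 𝔲(2,2)`, the operator `dω(X) := Σᵢ (aᵢ(X) : ℂ) • preᵢ ∘L genᵢ ∘L postᵢ` (`aᵢ(X) = (u22AdaptedBasis.repr X) i`, the letters ★ `u22LetterOp`) is a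
continuous `ℂ`-linear operator of `𝓢` and, for every `Φ ∈ 𝓢` and every continuous `ℝ`-linear `T : 𝓢 → V`,
`HasDerivAt (t ↦ T (ω (exp (t X), 1) Φ)) (T (dω(X) Φ)) 0` (★ `hasDerivAt_weilDatum_expMem_smul'`, `sum_apply ∕ smul_apply ∕ ContinuousLinearMap.comp_apply`).
[cite: Varadarajan1984, Thm. 2.10.1 and (2.10.19), p. 89] [cite: Folland1989, (4.24), Prop. (4.39)] -/
theorem hasDerivAt_weilDatum_expMem_smul_clm {ω : Representation ℂ (Ginf (Fin 2) (Fin 2) R S) (SchwartzMap (DPIdx (Fin 2) (Fin 2) R S → ℝ) ℂ)}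
    (hW : IsArchWeilDatum (ι𝕎 (Fin 2) (Fin 2) R S) ω) {e : VacExponents}
    (hvac : ∀ k : DPK (Fin 2) (Fin 2) R S, ω (κ (Fin 2) (Fin 2) R S k) (hermitePi 0) = vacScalar e k • hermitePi 0)
    (T : (SchwartzMap (DPIdx (Fin 2) (Fin 2) R S → ℝ) ℂ) →L[ℝ] V) (Φ : SchwartzMap (DPIdx (Fin 2) (Fin 2) R S → ℝ) ℂ)
    (X : ↥(uFormGroup (Fin 2) (Fin 2)).lie.toSubmodule) :
    HasDerivAt (fun t : ℝ => T (ω ((((uFormGroup (Fin 2) (Fin 2)).expMem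
        ⟨((t • X : ↥(uFormGroup (Fin 2) (Fin 2)).lie.toSubmodule) : Matrix (Fin 2 ⊕ Fin 2) (Fin 2 ⊕ Fin 2) ℂ), (t • X).2⟩ :
          UForm (Fin 2) (Fin 2)), (1 : UForm R S)) : Ginf (Fin 2) (Fin 2) R S) Φ))
      (T ((∑ i, (((u22AdaptedBasis.repr X) i : ℝ) : ℂ) •
        ((u22LetterOp R S e (u22FrameK i) (u22Kind i)).pre.comp
          (((u22LetterOp R S e (u22FrameK i) (u22Kind i)).gen).comp (u22LetterOp R S e (u22FrameK i) (u22Kind i)).post)) :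
          (SchwartzMap (DPIdx (Fin 2) (Fin 2) R S → ℝ) ℂ) →L[ℂ] SchwartzMap (DPIdx (Fin 2) (Fin 2) R S → ℝ) ℂ) Φ)) 0 := by
  have h := hasDerivAt_weilDatum_expMem_smul' hW hvac T Φ X
  simp only [sum_apply, smul_apply, ContinuousLinearMap.comp_apply]
  exact h

/-- **THE LIE DERIVATIVE ALONG `X ∈ 𝔲(2,2)` IS GIVEN BY ONE CONTINUOUS `ℂ`-LINEAR OPERATOR, UNIFORMLY IN THE VECTOR** (existential form of
`hasDerivAt_weilDatum_expMem_smul_clm` — the shape the (C2) closure organ consumes: `∃ D : 𝓢 →L[ℂ] 𝓢, ∀ T Φ, HasDerivAt (t ↦ T (ω (exp (t X), 1) Φ)) (T (D Φ)) 0`).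
[cite: Varadarajan1984, Thm. 2.10.1 and (2.10.19), p. 89] [cite: Folland1989, (4.24), Prop. (4.39)] -/
theorem exists_clm_hasDerivAt_weilDatum_expMem_smul {ω : Representation ℂ (Ginf (Fin 2) (Fin 2) R S) (SchwartzMap (DPIdx (Fin 2) (Fin 2) R S → ℝ) ℂ)}
    (hW : IsArchWeilDatum (ι𝕎 (Fin 2) (Fin 2) R S) ω) {e : VacExponents}
    (hvac : ∀ k : DPK (Fin 2) (Fin 2) R S, ω (κ (Fin 2) (Fin 2) R S k) (hermitePi 0) = vacScalar e k • hermitePi 0)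
    (X : ↥(uFormGroup (Fin 2) (Fin 2)).lie.toSubmodule) :
    ∃ D : (SchwartzMap (DPIdx (Fin 2) (Fin 2) R S → ℝ) ℂ) →L[ℂ] SchwartzMap (DPIdx (Fin 2) (Fin 2) R S → ℝ) ℂ,
      ∀ (T : (SchwartzMap (DPIdx (Fin 2) (Fin 2) R S → ℝ) ℂ) →L[ℝ] V) (Φ : SchwartzMap (DPIdx (Fin 2) (Fin 2) R S → ℝ) ℂ),
        HasDerivAt (fun t : ℝ => T (ω ((((uFormGroup (Fin 2) (Fin 2)).expMem
          ⟨((t • X : ↥(uFormGroup (Fin 2) (Fin 2)).lie.toSubmodule) : Matrix (Fin 2 ⊕ Fin 2) (Fin 2 ⊕ Fin 2) ℂ), (t • X).2⟩ :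
            UForm (Fin 2) (Fin 2)), (1 : UForm R S)) : Ginf (Fin 2) (Fin 2) R S) Φ)) (T (D Φ)) 0 :=
  ⟨_, fun T Φ => hasDerivAt_weilDatum_expMem_smul_clm hW hvac T Φ X⟩

end Summit.HodgeConjecture.HodgeConjecture.Cruxes.HLiu418.K2LiuWeilDatumSmoothU22

end
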